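import Mathlib.Tactic
import HarnessLib

/-!
# The N-line owners — the finite tie-break facts of PROPOSITION R

Kernel certificate (linear arithmetic, theorems only) of the bkey-order enumerations used in
`widen/W1/KNEST-w1cx1.md` §4 PROPOSITION R (W1 cell pub-hsemireg; code B's gauge of record).

A bimonomial `m = (i,j,k,l) ↔ x₁^i y₁^j x₂^k y₂^l` (`i,k ∈ {0,1,2}`) has factor levels
`ℓ(i,j) = i+j` (`j ≥ 0`) ∕ `-j` (`j < 0`), level `L(m) = max(ℓ(i,j), ℓ(k,l))`, and the gauge orders
monomials by `bkey(m) = (L, j, i, l, k)` lexicographically.  When `i + k = 2` its restriction to a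
graph curve is the single target `x² y^(j+l)`, so among such monomials the OWNER of the target
`x² y^t` inside a chart's monomial set `M` is the bkey-first element of `M` with `j + l = t`.
Below, `ℓ(i,j) ≤ L` etc. are written as implication pairs and «`bkey(m) < bkey(m₀)`» is spelled
out for the concrete `m₀`.  The chart sets: `M₃ = {j ≥ 0}` (chart `(0,01)`),
`M₄(a') = {2i + 3j ≤ a'}` (chart `(1,01)`), here with `a' ≤ 1`.

Certified: `ν₀₀ = (0,0,2,-1)` is bkey-first in `M₃` for the target `x² y⁻¹` (`nu00_first`);
`ν₀₋₁ = (0,-1,2,-1)` and `ν₀₋₂ = (0,-2,2,-1)` are bkey-first in `M₄(a')`, `a' ≤ 1`, for `x² y⁻²`,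
`x² y⁻³` (`nu0m1_first`, `nu0m2_first`); no monomial of the respective chart with the same target
lies strictly between each of them and its carrier `(1,0,1,-1)`, `(1,-1,1,-1)`, `(1,-2,1,-1)`
(`gap00`, `gap0m1`, `gap0m2`); and for `j ≤ -3` the new `a' = 1` monomial `(2,-1,0,j)` with target
`x² y^(j-1)` comes after the old `(0,j+1,2,-2)` (`new_x2_competitor_later`), so the owner of
`x² y^(j-1)` is unchanged under `+p`.  Nothing here is a statement about the Hodge conjecture.
-/

namespace Summit.Ventures.HSemireg.NLineOwners

/-- `ν₀₀ = (0,0,2,-1)` (level 1) is the bkey-first monomial of `M₃ = {j ≥ 0}` restricting to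
`x² y⁻¹`: no `(i,j,k,l)` with `j ≥ 0`, `i + k = 2`, `j + l = -1` precedes it. Here `L` is the level
of `(i,j,k,l)` (any common upper bound of the two factor levels that equals one of them suffices:
we only use `ℓ(i,j) ≤ L`, `ℓ(k,l) ≤ L`) and «precedes» is `bkey < (1, 0, 0, -1, 2)`. -/
theorem nu00_first {i j k l L : ℤ} (hi0 : 0 ≤ i) (hk0 : 0 ≤ k)
    (_h1 : (0 ≤ j → i + j ≤ L) ∧ (j < 0 → -j ≤ L)) (h2 : (0 ≤ l → k + l ≤ L) ∧ (l < 0 → -l ≤ L))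
    (hM : 0 ≤ j) (hs : i + k = 2) (ht : j + l = -1)
    (hlt : L < 1 ∨ (L = 1 ∧ (j < 0 ∨ (j = 0 ∧ (i < 0 ∨ (i = 0 ∧ (l < -1 ∨ (l = -1 ∧ k < 2)))))))) :
    False := by
  omega

/-- `ν₀₋₁ = (0,-1,2,-1)` (level 1, bkey `(1,-1,0,-1,2)`) is bkey-first in `M₄(a') = {2i+3j ≤ a'}`,
`a' ≤ 1`, for the target `x² y⁻²`. -/
theorem nu0m1_first {i j k l L a' : ℤ} (hi0 : 0 ≤ i) (hk0 : 0 ≤ k) (ha : a' ≤ 1)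
    (h1 : (0 ≤ j → i + j ≤ L) ∧ (j < 0 → -j ≤ L)) (h2 : (0 ≤ l → k + l ≤ L) ∧ (l < 0 → -l ≤ L))
    (hM : 2 * i + 3 * j ≤ a') (hs : i + k = 2) (ht : j + l = -2)
    (hlt : L < 1 ∨ (L = 1 ∧ (j < -1 ∨ (j = -1 ∧ (i < 0 ∨ (i = 0 ∧ (l < -1 ∨ (l = -1 ∧ k < 2)))))))) :
    False := by
  omega

/-- `ν₀₋₂ = (0,-2,2,-1)` (level 2, bkey `(2,-2,0,-1,2)`) is bkey-first in `M₄(a')`, `a' ≤ 1`, for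
the target `x² y⁻³`. -/
theorem nu0m2_first {i j k l L a' : ℤ} (hi0 : 0 ≤ i) (hk0 : 0 ≤ k) (ha : a' ≤ 1)
    (h1 : (0 ≤ j → i + j ≤ L) ∧ (j < 0 → -j ≤ L)) (h2 : (0 ≤ l → k + l ≤ L) ∧ (l < 0 → -l ≤ L))
    (hM : 2 * i + 3 * j ≤ a') (hs : i + k = 2) (ht : j + l = -3)
    (hlt : L < 2 ∨ (L = 2 ∧ (j < -2 ∨ (j = -2 ∧ (i < 0 ∨ (i = 0 ∧ (l < -1 ∨ (l = -1 ∧ k < 2)))))))) :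
    False := by
  omega

/-- No `M₃`-monomial with target `x² y⁻¹` lies strictly between `ν₀₀ = (0,0,2,-1)` and its carrier
`(1,0,1,-1)` (bkey `(1,0,1,-1,1)`): the functional «coefficient of `ν₀₀`» vanishes on every
earlier basis vector of chart `(0,01)`. `hgt`∕`hlt` spell `bkey(ν₀₀) < bkey(m) < bkey(1,0,1,-1)`
(both have level `1`). -/
theorem gap00 {i j k l L : ℤ} (hi0 : 0 ≤ i) (hk0 : 0 ≤ k) (_hL1 : (0 ≤ j → i + j ≤ L) ∧ (j < 0 → -j ≤ L))
    (_hL2 : (0 ≤ l → k + l ≤ L) ∧ (l < 0 → -l ≤ L)) (_hLe : L = i + j ∨ L = -j ∨ L = k + l ∨ L = -l)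
    (hM : 0 ≤ j) (hs : i + k = 2) (ht : j + l = -1)
    (hgt : 1 < L ∨ (L = 1 ∧ (0 < j ∨ (j = 0 ∧ (0 < i ∨ (i = 0 ∧ (-1 < l ∨ (l = -1 ∧ 2 < k))))))))
    (hlt : L < 1 ∨ (L = 1 ∧ (j < 0 ∨ (j = 0 ∧ (i < 1 ∨ (i = 1 ∧ (l < -1 ∨ (l = -1 ∧ k < 1)))))))) :
    False := by
  omega

/-- No `M₄(a')`-monomial (`a' ≤ 1`) with target `x² y⁻²` lies strictly between `ν₀₋₁ = (0,-1,2,-1)`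
(bkey `(1,-1,0,-1,2)`) and its carrier `(1,-1,1,-1)` (bkey `(1,-1,1,-1,1)`). -/
theorem gap0m1 {i j k l L a' : ℤ} (hi0 : 0 ≤ i) (hk0 : 0 ≤ k) (_ha : a' ≤ 1)
    (_hL1 : (0 ≤ j → i + j ≤ L) ∧ (j < 0 → -j ≤ L)) (_hL2 : (0 ≤ l → k + l ≤ L) ∧ (l < 0 → -l ≤ L))
    (_hLe : L = i + j ∨ L = -j ∨ L = k + l ∨ L = -l)
    (_hM : 2 * i + 3 * j ≤ a') (hs : i + k = 2) (ht : j + l = -2)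
    (hgt : 1 < L ∨ (L = 1 ∧ (-1 < j ∨ (j = -1 ∧ (0 < i ∨ (i = 0 ∧ (-1 < l ∨ (l = -1 ∧ 2 < k))))))))
    (hlt : L < 1 ∨ (L = 1 ∧ (j < -1 ∨ (j = -1 ∧ (i < 1 ∨ (i = 1 ∧ (l < -1 ∨ (l = -1 ∧ k < 1)))))))) :
    False := by
  omega

/-- No `M₄(a')`-monomial (`a' ≤ 1`) with target `x² y⁻³` lies strictly between `ν₀₋₂ = (0,-2,2,-1)`
(bkey `(2,-2,0,-1,2)`) and its carrier `(1,-2,1,-1)` (bkey `(2,-2,1,-1,1)`). -/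
theorem gap0m2 {i j k l L a' : ℤ} (hi0 : 0 ≤ i) (hk0 : 0 ≤ k) (_ha : a' ≤ 1)
    (_hL1 : (0 ≤ j → i + j ≤ L) ∧ (j < 0 → -j ≤ L)) (_hL2 : (0 ≤ l → k + l ≤ L) ∧ (l < 0 → -l ≤ L))
    (_hLe : L = i + j ∨ L = -j ∨ L = k + l ∨ L = -l)
    (_hM : 2 * i + 3 * j ≤ a') (hs : i + k = 2) (ht : j + l = -3)
    (hgt : 2 < L ∨ (L = 2 ∧ (-2 < j ∨ (j = -2 ∧ (0 < i ∨ (i = 0 ∧ (-1 < l ∨ (l = -1 ∧ 2 < k))))))))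
    (hlt : L < 2 ∨ (L = 2 ∧ (j < -2 ∨ (j = -2 ∧ (i < 1 ∨ (i = 1 ∧ (l < -1 ∨ (l = -1 ∧ k < 1)))))))) :
    False := by
  omega

/-- Under `+p` (`a' : 0 → 1`) the only new monomial with target `x² y^(j-1)` is `(2,-1,0,j)`
(level `max(1, -j)`); for `j ≤ -3` the old monomial `(0, j+1, 2, -2)` (level `max(-(j+1), 2) = -j-1`)
has the same target and strictly smaller level, so the owner of `x² y^(j-1)` — the target of the
regular carrier `ν₀ⱼ = (0,j,2,-1)` — is an OLD monomial in `M₄(1)` as in `M₄(0)` (cochain identity). -/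
theorem new_x2_competitor_later (j : ℤ) (hj : j ≤ -3) :
    (0 + (j + 1) + (2 + (-2)) = 2 + (-1) + (0 + j)) ∧   -- same target exponent j - 1 (as j+l sums)
    max (-(j + 1)) 2 < max 1 (-j) := by
  refine ⟨by ring, ?_⟩
  rw [max_lt_iff]
  constructor
  · exact lt_max_of_lt_right (by omega)
  · exact lt_max_of_lt_right (by omega)

end Summit.Ventures.HSemireg.NLineOwners
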